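import Mathlib
import Literature.Computability.AlgebraicComplexity.LR21Datum
import Literature.Computability.AlgebraicComplexity.StandardFamilies
import Summits.ValiantsHypothesis.ValiantsHypothesis.Theorems.RigidityForcesSymmetryPairTiedTorusBoundDefs
import Summits.ValiantsHypothesis.ValiantsHypothesis.Theorems.RigidityForcesSymmetryRankRigidMinimalReprWeightTyping
import Summits.ValiantsHypothesis.ValiantsHypothesis.Theorems.RigidityForcesSymmetryRankRigidMinimalReprPathExpansion
import Summits.ValiantsHypothesis.ValiantsHypothesis.Theorems.FreeSubtorusOrbitDimensionBoundPerInvariantWeightTyping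

/-!
# Crux `OrbitDimensionBound` (stmt-ValiantsHypothesis-16133), line `affine_multiple`, stub `stub_perInvariantTorusBound` —
# step 2: the level nodes of a path expansion graded by the PER-INVARIANT torus `T¹`

Route `ValiantsHypothesis/FreeSubtorus`, registered skeleton `Cruxes/OrbitDimensionBound/Lines/affine_multiple.lean`, stub
`stub_perInvariantTorusBound` (helper 2).  The `T¹` analogue of `LevelNodes.levelDecomp_of_graded_path_expansion`
(`…RankRigidMinimalReprLevelNodes.lean`, crux 18034): `b, c, D` linear with `-bᵀ D^{(n+1)-2} c = κ · perm_{n+1}` and weight-graded for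
the generic element of `T¹` (row `k ↦ p_k = primes₂ (inl k)`, column `j ≠ last ↦ q_j = primes₂ (inr j)`, last column `↦ Ω⁻¹`,
`Ω = ∏ p ∏_{j ≠ last} q`, so `∏ d ∏ e = 1` and the sink weight equals the source weight `γ₀`).  The weight calculus
`WeightTyping.carries_*` is imported by name; the natural weight is `N(δ) · Ω^{-c_last(δ)}` (`prod_weight_mul_omega_pow`); the
pairing identity is `N(δ) N(δ') = Ω^{c_last(δ)+c_last(δ')}` in `ℕ`; the typing is `PerInvariantTyping.typed_of_perInvariant_weights`;
a node lives at ONE level because `(n+1) · t = deg P + deg Q` pins the level modulo `n + 1` (`sum_add_sum_eq_mul_of_pairing`).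
Output: `TiedLevelDecomposable (n+1) 0 s (w s)` for `1 ≤ s ≤ n` with `Σ_s w s + 1 ≤ N + 1` (`N` internal nodes).

HONEST FRAMING: helper toward ONE registered stub of a forward rung inside one route; the crux `OrbitDimensionBound` stays OPEN;
census-neutral; `VP ≠ VNP` is NOT proved and nothing here bears on it.
-/

set_option autoImplicit false

-- the mandated summit-side namespace repeats a component by design (single-problem summit)
set_option linter.dupNamespace false

noncomputable section

open MvPolynomial Finset Matrix
open Literature.Computability.AlgebraicComplexity LRPencil
open Summit.ValiantsHypothesis.ValiantsHypothesis.Theorems.RigidityForcesSymmetryPairTiedTorusBound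
open Summit.ValiantsHypothesis.ValiantsHypothesis.Theorems.RigidityForcesSymmetryRankRigidMinimalRepr

namespace Summit.ValiantsHypothesis.ValiantsHypothesis.Theorems.FreeSubtorusOrbitDimensionBound

namespace PerInvariantTyping

variable {n : ℕ}

/-- Under the pairing identity `N(δ) N(δ') = Ω^{c_last(δ) + c_last(δ')}` the degrees add up to a MULTIPLE of `n + 1`:
`deg δ + deg δ' = (n+1) · (c_last(δ) + c_last(δ'))` (row by row, unique factorisation). -/
theorem sum_add_sum_eq_mul_of_pairing {δ δ' : (Fin (n + 1) × Fin (n + 1)) →₀ ℕ}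
    (h : ((∏ k : Fin (n + 1), primes₂ (n + 1) (Sum.inl k) ^ (∑ j, δ (k, j))) *
          ∏ j : Fin n, primes₂ (n + 1) (Sum.inr (Fin.castSucc j)) ^ (∑ k, δ (k, Fin.castSucc j))) *
        ((∏ k : Fin (n + 1), primes₂ (n + 1) (Sum.inl k) ^ (∑ j, δ' (k, j))) *
          ∏ j : Fin n, primes₂ (n + 1) (Sum.inr (Fin.castSucc j)) ^ (∑ k, δ' (k, Fin.castSucc j))) =
      ((∏ k : Fin (n + 1), primes₂ (n + 1) (Sum.inl k)) *
          ∏ j : Fin n, primes₂ (n + 1) (Sum.inr (Fin.castSucc j))) ^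
        ((∑ k, δ (k, Fin.last n)) + ∑ k, δ' (k, Fin.last n))) :
    (∑ v, δ v) + ∑ v, δ' v = (n + 1) * ((∑ k, δ (k, Fin.last n)) + ∑ k, δ' (k, Fin.last n)) := by
  classical
  rw [prod_weightN_eq_prod_primes_pow δ, prod_weightN_eq_prod_primes_pow δ', omega_pow_eq_prod_primes_pow,
    ← Finset.prod_mul_distrib] at h
  have h' := eq_of_prod_prime_pow_eq_fintype (primes₂_prime (n + 1)) (primes₂_injective (n + 1))
    (a := fun x => Sum.elim (fun k => ∑ j, δ (k, j)) (fun j => if j = Fin.last n then 0 else ∑ k, δ (k, j)) x +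
      Sum.elim (fun k => ∑ j, δ' (k, j)) (fun j => if j = Fin.last n then 0 else ∑ k, δ' (k, j)) x)
    (by rw [← h]; exact Finset.prod_congr rfl fun x _ => by rw [pow_add])
  have hrows : ∀ k : Fin (n + 1), (∑ j, δ (k, j)) + ∑ j, δ' (k, j) =
      (∑ k, δ (k, Fin.last n)) + ∑ k, δ' (k, Fin.last n) := fun k => by
    have := congrFun h' (Sum.inl k); simpa using this
  rw [sum_eq_sum_rows, sum_eq_sum_rows, ← Finset.sum_add_distrib, Finset.sum_congr rfl fun k _ => hrows k,
    Finset.sum_const, Finset.card_univ, Fintype.card_fin, smul_eq_mul]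

end PerInvariantTyping

namespace PerInvariantLevelNodes

open WeightTyping PerInvariantTyping

variable {n : ℕ}

/-- The complex weight of a monomial for the generic `T¹` element, cleared of its denominator:
`(∏_v (p_{v.1} · e_{v.2})^{δ_v}) · Ω^{c_last(δ)} = N(δ)` with `e_j = q_j` (`j ≠ last`), `e_last = Ω⁻¹`. -/
theorem prod_weight_mul_omega_pow (δ : (Fin (n + 1) × Fin (n + 1)) →₀ ℕ) :
    (∏ v : Fin (n + 1) × Fin (n + 1), ((primes₂ (n + 1) (Sum.inl v.1) : ℂ) *
        (if v.2 = Fin.last n then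
          (((∏ k : Fin (n + 1), primes₂ (n + 1) (Sum.inl k)) *
              ∏ j : Fin n, primes₂ (n + 1) (Sum.inr (Fin.castSucc j)) : ℕ) : ℂ)⁻¹
         else (primes₂ (n + 1) (Sum.inr v.2) : ℂ))) ^ δ v) *
      ((((∏ k : Fin (n + 1), primes₂ (n + 1) (Sum.inl k)) *
          ∏ j : Fin n, primes₂ (n + 1) (Sum.inr (Fin.castSucc j)) : ℕ) : ℂ)) ^ (∑ k, δ (k, Fin.last n)) =
      (((∏ k : Fin (n + 1), primes₂ (n + 1) (Sum.inl k) ^ (∑ j, δ (k, j))) *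
          ∏ j : Fin n, primes₂ (n + 1) (Sum.inr (Fin.castSucc j)) ^ (∑ k, δ (k, Fin.castSucc j)) : ℕ) : ℂ) := by
  set Ω : ℕ := (∏ k : Fin (n + 1), primes₂ (n + 1) (Sum.inl k)) *
    ∏ j : Fin n, primes₂ (n + 1) (Sum.inr (Fin.castSucc j)) with hΩ
  have hΩ0 : (Ω : ℂ) ≠ 0 := by
    rw [hΩ]; push_cast
    exact mul_ne_zero (Finset.prod_ne_zero_iff.2 fun k _ => primes₂_cast_ne_zero (n + 1) _)
      (Finset.prod_ne_zero_iff.2 fun j _ => primes₂_cast_ne_zero (n + 1) _)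
  set e : Fin (n + 1) → ℂ := fun j => if j = Fin.last n then (Ω : ℂ)⁻¹ else (primes₂ (n + 1) (Sum.inr j) : ℂ) with he
  have hsplit : (∏ v : Fin (n + 1) × Fin (n + 1), ((primes₂ (n + 1) (Sum.inl v.1) : ℂ) * e v.2) ^ δ v) =
      (∏ k : Fin (n + 1), (primes₂ (n + 1) (Sum.inl k) : ℂ) ^ (∑ j, δ (k, j))) *
        ((∏ j : Fin n, (primes₂ (n + 1) (Sum.inr (Fin.castSucc j)) : ℂ) ^ (∑ k, δ (k, Fin.castSucc j))) *
          ((Ω : ℂ)⁻¹) ^ (∑ k, δ (k, Fin.last n))) := by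
    simp only [mul_pow, Finset.prod_mul_distrib]
    congr 1
    · rw [Fintype.prod_prod_type]
      exact Finset.prod_congr rfl fun k _ =>
        Finset.prod_pow_eq_pow_sum univ (fun j => δ (k, j)) (primes₂ (n + 1) (Sum.inl k) : ℂ)
    · rw [Fintype.prod_prod_type_right, Fin.prod_univ_castSucc]
      dsimp only
      congr 1
      · refine Finset.prod_congr rfl fun j _ => ?_
        rw [Finset.prod_pow_eq_pow_sum univ (fun k => δ (k, Fin.castSucc j)) (e (Fin.castSucc j)), he]
        dsimp only
        rw [if_neg (Fin.castSucc_lt_last j).ne]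
      · rw [Finset.prod_pow_eq_pow_sum univ (fun k => δ (k, Fin.last n)) (e (Fin.last n)), he]
        dsimp only
        rw [if_pos rfl]
  rw [hsplit, mul_assoc, mul_assoc, ← mul_pow, inv_mul_cancel₀ hΩ0, one_pow, mul_one]
  push_cast
  rfl

/-- The character of the generic `T¹` element is `1`: `(∏_k p_k) · (∏_j e_j) = 1`. -/
theorem character_eq_one :
    ((∏ k : Fin (n + 1), (primes₂ (n + 1) (Sum.inl k) : ℂ)) *
        ∏ j : Fin (n + 1), (if j = Fin.last n then
          (((∏ k : Fin (n + 1), primes₂ (n + 1) (Sum.inl k)) *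
              ∏ j : Fin n, primes₂ (n + 1) (Sum.inr (Fin.castSucc j)) : ℕ) : ℂ)⁻¹
         else (primes₂ (n + 1) (Sum.inr j) : ℂ))) = 1 := by
  set Ω : ℕ := (∏ k : Fin (n + 1), primes₂ (n + 1) (Sum.inl k)) *
    ∏ j : Fin n, primes₂ (n + 1) (Sum.inr (Fin.castSucc j)) with hΩ
  have hΩ0 : (Ω : ℂ) ≠ 0 := by
    rw [hΩ]; push_cast
    exact mul_ne_zero (Finset.prod_ne_zero_iff.2 fun k _ => primes₂_cast_ne_zero (n + 1) _)
      (Finset.prod_ne_zero_iff.2 fun j _ => primes₂_cast_ne_zero (n + 1) _)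
  have h1 : (∏ j : Fin (n + 1), (if j = Fin.last n then (Ω : ℂ)⁻¹ else (primes₂ (n + 1) (Sum.inr j) : ℂ))) =
      (∏ j : Fin n, (primes₂ (n + 1) (Sum.inr (Fin.castSucc j)) : ℂ)) * (Ω : ℂ)⁻¹ := by
    rw [Fin.prod_univ_castSucc, if_pos rfl]
    congr 1
    exact Finset.prod_congr rfl fun j _ => by rw [if_neg (Fin.castSucc_lt_last j).ne]
  rw [h1, ← mul_assoc]
  have h2 : ((∏ k : Fin (n + 1), (primes₂ (n + 1) (Sum.inl k) : ℂ)) *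
      ∏ j : Fin n, (primes₂ (n + 1) (Sum.inr (Fin.castSucc j)) : ℂ)) = (Ω : ℂ) := by
    rw [hΩ]; push_cast; rfl
  rw [h2, mul_inv_cancel₀ hΩ0]

/-- **Level nodes of a `T¹`-graded path expansion.**  From `-bᵀ D^{(n+1)-2} c = κ perm_{n+1}` with `b, c, D` linear and weight-graded for
the generic `T¹` element (node weights `θ`, source weight `γ₀ ≠ 0`, sink weight `(∏ p ∏ e) γ₀`), typed level decompositions of
`perm_{n+1}` (`TiedLevelDecomposable (n+1) 0`) with `w s` products at each level `1 ≤ s ≤ n` and `Σ_s w s + 1 ≤ N + 1`. -/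
theorem levelDecomp_of_graded_path_expansion {N : ℕ}
    (b c : Fin N → MvPolynomial (Fin (n + 1) × Fin (n + 1)) ℂ)
    (D : Matrix (Fin N) (Fin N) (MvPolynomial (Fin (n + 1) × Fin (n + 1)) ℂ))
    (hb : ∀ j, (b j).IsHomogeneous 1) (hc : ∀ j, (c j).IsHomogeneous 1) (hD : ∀ i j, (D i j).IsHomogeneous 1)
    (κ : ℂ) (hκ : κ ≠ 0) (hpath : -(b ⬝ᵥ (D ^ (n + 1 - 2)) *ᵥ c) = C κ * perPoly (Fin (n + 1)) ℂ)
    (θ : Fin N → ℂ) (γ₀ : ℂ) (hγ₀ : γ₀ ≠ 0)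
    (hbw : ∀ s, ∀ δ ∈ (b s).support,
      (∏ v : Fin (n + 1) × Fin (n + 1), ((primes₂ (n + 1) (Sum.inl v.1) : ℂ) *
        (if v.2 = Fin.last n then
          (((∏ k : Fin (n + 1), primes₂ (n + 1) (Sum.inl k)) *
              ∏ j : Fin n, primes₂ (n + 1) (Sum.inr (Fin.castSucc j)) : ℕ) : ℂ)⁻¹
         else (primes₂ (n + 1) (Sum.inr v.2) : ℂ))) ^ δ v) * θ s =
        ((∏ k : Fin (n + 1), (primes₂ (n + 1) (Sum.inl k) : ℂ)) *
          ∏ j : Fin (n + 1), (if j = Fin.last n then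
            (((∏ k : Fin (n + 1), primes₂ (n + 1) (Sum.inl k)) *
                ∏ j : Fin n, primes₂ (n + 1) (Sum.inr (Fin.castSucc j)) : ℕ) : ℂ)⁻¹
           else (primes₂ (n + 1) (Sum.inr j) : ℂ))) * γ₀)
    (hcw : ∀ r, ∀ δ ∈ (c r).support,
      (∏ v : Fin (n + 1) × Fin (n + 1), ((primes₂ (n + 1) (Sum.inl v.1) : ℂ) *
        (if v.2 = Fin.last n then
          (((∏ k : Fin (n + 1), primes₂ (n + 1) (Sum.inl k)) *
              ∏ j : Fin n, primes₂ (n + 1) (Sum.inr (Fin.castSucc j)) : ℕ) : ℂ)⁻¹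
         else (primes₂ (n + 1) (Sum.inr v.2) : ℂ))) ^ δ v) * γ₀ = θ r)
    (hDw : ∀ r s, ∀ δ ∈ (D r s).support,
      (∏ v : Fin (n + 1) × Fin (n + 1), ((primes₂ (n + 1) (Sum.inl v.1) : ℂ) *
        (if v.2 = Fin.last n then
          (((∏ k : Fin (n + 1), primes₂ (n + 1) (Sum.inl k)) *
              ∏ j : Fin n, primes₂ (n + 1) (Sum.inr (Fin.castSucc j)) : ℕ) : ℂ)⁻¹
         else (primes₂ (n + 1) (Sum.inr v.2) : ℂ))) ^ δ v) * θ s = θ r) :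
    ∃ w : ℕ → ℕ, (∑ s ∈ Finset.range n, w (s + 1)) + 1 ≤ N + 1 ∧
      ∀ s : ℕ, 1 ≤ s → s + 1 ≤ n + 1 → TiedLevelDecomposable (n + 1) 0 s (w s) := by
  classical
  -- names: the natural weight `NW`, the last-column degree `cl`, `Ω`, the complex variable weight `wv`
  set Ω : ℕ := (∏ k : Fin (n + 1), primes₂ (n + 1) (Sum.inl k)) *
    ∏ j : Fin n, primes₂ (n + 1) (Sum.inr (Fin.castSucc j)) with hΩ
  set wv : Fin (n + 1) × Fin (n + 1) → ℂ := fun v => ((primes₂ (n + 1) (Sum.inl v.1) : ℂ) *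
    (if v.2 = Fin.last n then (Ω : ℂ)⁻¹ else (primes₂ (n + 1) (Sum.inr v.2) : ℂ))) with hwv
  set NW : ((Fin (n + 1) × Fin (n + 1)) →₀ ℕ) → ℕ := fun δ =>
    (∏ k : Fin (n + 1), primes₂ (n + 1) (Sum.inl k) ^ (∑ j, δ (k, j))) *
      ∏ j : Fin n, primes₂ (n + 1) (Sum.inr (Fin.castSucc j)) ^ (∑ k, δ (k, Fin.castSucc j)) with hNW
  set cl : ((Fin (n + 1) × Fin (n + 1)) →₀ ℕ) → ℕ := fun δ => ∑ k, δ (k, Fin.last n) with hcl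
  have hΩ0 : (Ω : ℂ) ≠ 0 := by
    rw [hΩ]; push_cast
    exact mul_ne_zero (Finset.prod_ne_zero_iff.2 fun k _ => primes₂_cast_ne_zero (n + 1) _)
      (Finset.prod_ne_zero_iff.2 fun j _ => primes₂_cast_ne_zero (n + 1) _)
  have hW : ∀ δ, (∏ v, wv v ^ δ v) * (Ω : ℂ) ^ cl δ = (NW δ : ℂ) := fun δ => prod_weight_mul_omega_pow δ
  have hchar := (character_eq_one (n := n))
  -- the level polynomials
  set Ps : ℕ → Fin N → MvPolynomial (Fin (n + 1) × Fin (n + 1)) ℂ :=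
    fun s u => C (-κ⁻¹) * (b ᵥ* D ^ (s - 1)) u with hPs
  set Qs : ℕ → Fin N → MvPolynomial (Fin (n + 1) × Fin (n + 1)) ℂ :=
    fun s u => (D ^ (n - s) *ᵥ c) u with hQs
  -- (a) the identity at each level
  have hsum : ∀ s, 1 ≤ s → s ≤ n → perPoly (Fin (n + 1)) ℂ = ∑ u, Ps s u * Qs s u := by
    intro s hs1 hsm
    have e1 : n + 1 - 2 = (s - 1) + (n - s) := by omega
    have h1 : b ⬝ᵥ (D ^ (n + 1 - 2)) *ᵥ c = ∑ u, (b ᵥ* D ^ (s - 1)) u * (D ^ (n - s) *ᵥ c) u := by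
      rw [e1, pow_add, ← Matrix.mulVec_mulVec, Matrix.dotProduct_mulVec]; rfl
    have h2 : perPoly (Fin (n + 1)) ℂ = C κ⁻¹ * (C κ * perPoly (Fin (n + 1)) ℂ) := by
      rw [← mul_assoc, ← C_mul, inv_mul_cancel₀ hκ, C_1, one_mul]
    rw [h2, ← hpath, h1, mul_neg, Finset.mul_sum, ← Finset.sum_neg_distrib]
    refine Finset.sum_congr rfl fun u _ => ?_
    rw [hPs, hQs, map_neg]
    ring
  -- (b) weights
  have hDpow : ∀ (i : ℕ) (r s : Fin N), ∀ δ ∈ ((D ^ i) r s).support, (∏ v, wv v ^ δ v) * θ s = θ r :=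
    carries_pow_apply wv hDw
  have hPw : ∀ s u, ∀ δ ∈ (Ps s u).support, (∏ v, wv v ^ δ v) * θ u = γ₀ := by
    intro s u δ hδ
    have h := carries_C_mul wv (-κ⁻¹) (carries_vecMul wv hbw (hDpow (s - 1)) u) δ hδ
    rw [hchar, one_mul] at h
    exact h
  have hQw : ∀ s u, ∀ δ ∈ (Qs s u).support, (∏ v, wv v ^ δ v) * γ₀ = θ u := by
    intro s u δ hδ
    exact carries_mulVec wv hcw (hDpow (n - s)) u δ hδ
  have hpair : ∀ s s' u, ∀ δ ∈ (Ps s u).support, ∀ δ' ∈ (Qs s' u).support, NW δ * NW δ' = Ω ^ (cl δ + cl δ') := by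
    intro s s' u δ hδ δ' hδ'
    have h1 := hPw s u δ hδ
    have h2 := hQw s' u δ' hδ'
    rw [← h2, ← mul_assoc] at h1
    have h3 : (∏ v, wv v ^ δ v) * (∏ v, wv v ^ δ' v) = 1 := by
      have := mul_right_cancel₀ hγ₀ (h1.trans (one_mul γ₀).symm)
      exact this
    have h4 : ((NW δ * NW δ' : ℕ) : ℂ) = ((Ω ^ (cl δ + cl δ') : ℕ) : ℂ) := by
      push_cast
      rw [← hW δ, ← hW δ', pow_add]
      calc (∏ v, wv v ^ δ v) * (Ω : ℂ) ^ cl δ * ((∏ v, wv v ^ δ' v) * (Ω : ℂ) ^ cl δ')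
          = ((∏ v, wv v ^ δ v) * ∏ v, wv v ^ δ' v) * ((Ω : ℂ) ^ cl δ * (Ω : ℂ) ^ cl δ') := by ring
        _ = (Ω : ℂ) ^ cl δ * (Ω : ℂ) ^ cl δ' := by rw [h3, one_mul]
    exact_mod_cast h4
  -- (c) degrees
  have hPdeg : ∀ s, 1 ≤ s → ∀ u, ∀ δ ∈ (Ps s u).support, (∑ v, δ v) = s := by
    intro s hs1 u δ hδ
    have hhom : (Ps s u).IsHomogeneous s := by
      rw [hPs]
      refine IsHomogeneous.C_mul ?_ _
      rw [Matrix.vecMul, dotProduct]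
      refine IsHomogeneous.sum _ _ _ fun t _ => ?_
      have := (hb t).mul (PathExpansion.isHomogeneous_pow_apply hD (s - 1) t u)
      rwa [show 1 + (s - 1) = s by omega] at this
    have hd : δ.degree = s := by
      by_contra hne
      exact (MvPolynomial.mem_support_iff.1 hδ) (hhom.coeff_eq_zero hne)
    rw [← Finsupp.degree_eq_sum]; exact hd
  have hQdeg : ∀ s, s ≤ n → ∀ u, ∀ δ ∈ (Qs s u).support, (∑ v, δ v) + s = n + 1 := by
    intro s hsn u δ hδ
    have hhom : (Qs s u).IsHomogeneous (n - s + 1) := by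
      simp only [hQs, Matrix.mulVec, dotProduct]
      refine IsHomogeneous.sum _ _ _ fun t _ => ?_
      exact (PathExpansion.isHomogeneous_pow_apply hD (n - s) u t).mul (hc t)
    have hd : δ.degree = n - s + 1 := by
      by_contra hne
      exact (MvPolynomial.mem_support_iff.1 hδ) (hhom.coeff_eq_zero hne)
    rw [← Finsupp.degree_eq_sum, hd]; omega
  -- (d) the good nodes of each level
  set Good : ℕ → Finset (Fin N) := fun s => univ.filter (fun u => Ps s u ≠ 0 ∧ Qs s u ≠ 0) with hGood
  refine ⟨fun s => (Good s).card, ?_, ?_⟩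
  · -- the count: a node is good at one level only (`(n+1) t = deg P + deg Q`)
    have hdisj : ∀ s ∈ Finset.range n, ∀ s' ∈ Finset.range n, s ≠ s' →
        Disjoint (Good (s + 1)) (Good (s' + 1)) := by
      intro s hs s' hs' hss'
      rw [Finset.mem_range] at hs hs'
      rw [Finset.disjoint_left]
      intro u hu hu'
      rw [hGood, mem_filter] at hu hu'
      apply hss'
      obtain ⟨δ₁, hδ₁⟩ : ∃ δ, δ ∈ (Ps (s + 1) u).support := by
        obtain ⟨d, hd⟩ := MvPolynomial.ne_zero_iff.1 hu.2.1; exact ⟨d, MvPolynomial.mem_support_iff.2 hd⟩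
      obtain ⟨δ₂, hδ₂⟩ : ∃ δ, δ ∈ (Ps (s' + 1) u).support := by
        obtain ⟨d, hd⟩ := MvPolynomial.ne_zero_iff.1 hu'.2.1; exact ⟨d, MvPolynomial.mem_support_iff.2 hd⟩
      obtain ⟨δ', hδ'⟩ : ∃ δ', δ' ∈ (Qs (s + 1) u).support := by
        obtain ⟨d, hd⟩ := MvPolynomial.ne_zero_iff.1 hu.2.2; exact ⟨d, MvPolynomial.mem_support_iff.2 hd⟩
      have e1 := sum_add_sum_eq_mul_of_pairing (hpair (s + 1) (s + 1) u δ₁ hδ₁ δ' hδ')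
      have e2 := sum_add_sum_eq_mul_of_pairing (hpair (s' + 1) (s + 1) u δ₂ hδ₂ δ' hδ')
      have d1 := hPdeg (s + 1) (by omega) u δ₁ hδ₁
      have d2 := hPdeg (s' + 1) (by omega) u δ₂ hδ₂
      have d3 := hQdeg (s + 1) (by omega) u δ' hδ'
      rw [d1] at e1
      rw [d2] at e2
      -- `(n+1) ∣ (s+1) + deg δ'` and `(n+1) ∣ (s'+1) + deg δ'` with `s, s' < n`
      have hlt : (s + 1) + ∑ v, δ' v < 2 * (n + 1) := by omega
      have hlt' : (s' + 1) + ∑ v, δ' v < 2 * (n + 1) := by omega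
      set t1 := cl δ₁ + cl δ' with ht1
      set t2 := cl δ₂ + cl δ' with ht2
      have : t1 ≤ 1 := by nlinarith
      have : t2 ≤ 1 := by nlinarith
      have : 1 ≤ t1 := by
        by_contra! h0
        have : t1 = 0 := by omega
        rw [this] at e1; omega
      have : 1 ≤ t2 := by
        by_contra! h0
        have : t2 = 0 := by omega
        rw [this] at e2; omega
      have : t1 = t2 := by omega
      rw [this] at e1
      omega
    have hcard : (∑ s ∈ Finset.range n, (Good (s + 1)).card) =
        ((Finset.range n).biUnion fun s => Good (s + 1)).card :=
      (Finset.card_biUnion hdisj).symm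
    have hle : ((Finset.range n).biUnion fun s => Good (s + 1)).card ≤ N := by
      have := Finset.card_le_univ ((Finset.range n).biUnion fun s => Good (s + 1))
      rwa [Fintype.card_fin] at this
    show (∑ s ∈ Finset.range n, (Good (s + 1)).card) + 1 ≤ N + 1
    omega
  · -- the decomposition at level `s`
    intro s hs1 hsm
    have hsm' : s ≤ n := by omega
    have typed : ∀ u ∈ Good s, ∃ (I : Finset (Fin (n + 1))) (cc cc' : Fin (n + 1) → ℕ) (ct ct' : ℕ),
        I.card = s ∧ IsTiedTyped (n + 1) 0 I cc ct (Ps s u) ∧ IsTiedTyped (n + 1) 0 Iᶜ cc' ct' (Qs s u) ∧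
        (∀ j : Fin (n + 1), 0 < j.val → cc j + cc' j = 1) ∧
        ct + ct' = (univ.filter fun j : Fin (n + 1) => j.val ≤ 0).card := by
      intro u hu
      rw [hGood, mem_filter] at hu
      exact typed_of_perInvariant_weights (hpair s s u) hu.2.1 hu.2.2 (hPdeg s hs1 u) (hQdeg s hsm' u)
    choose! I cc cc' ct ct' hI hPt hQt hcc hct using typed
    set e := (Good s).equivFin with he
    refine ⟨fun t => I (e.symm t), fun t => cc (e.symm t), fun t => cc' (e.symm t), fun t => ct (e.symm t),
      fun t => ct' (e.symm t), fun t => Ps s (e.symm t), fun t => Qs s (e.symm t),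
      fun t => hI _ (e.symm t).2, fun t => hPt _ (e.symm t).2, fun t => hQt _ (e.symm t).2,
      fun t => hcc _ (e.symm t).2, fun t => hct _ (e.symm t).2, ?_⟩
    rw [hsum s hs1 hsm']
    have h1 : ∑ u, Ps s u * Qs s u = ∑ u ∈ Good s, Ps s u * Qs s u := by
      rw [hGood, Finset.sum_filter_of_ne]
      intro u _ hne
      constructor
      · intro h0; exact hne (by rw [h0, zero_mul])
      · intro h0; exact hne (by rw [h0, mul_zero])
    rw [h1, ← Finset.sum_coe_sort (Good s)]
    exact (Equiv.sum_comp e.symm (fun x : ↥(Good s) => Ps s x * Qs s x)).symm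

end PerInvariantLevelNodes

end Summit.ValiantsHypothesis.ValiantsHypothesis.Theorems.FreeSubtorusOrbitDimensionBound

end
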